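import Summits.CriticalPhenomena.PercolationContinuityZ3.Theorems.Transplant.KNCells2ChainCorridorS
import Summits.CriticalPhenomena.PercolationContinuityZ3.Theorems.Transplant.KNCells2ChainBandRO
import HarnessLib

/-!
# Residue (C) of route D″ v2, THE CORRIDOR SCHEDULE, ROOTED-BAND VARIANT (finding F-DP4-2, DPRIME-CHECKLIST DP4(v); stmt-g9 06:18:11Z/06:40:02Z):
# `Corr.scheduleR := (Loc⊥ ++ Loc∥) ++ Band.scheduleRO` over `Corr.CorrROK` (phase 3 admissible by p1-g10's `Band.BandOKR`, NO `hρ0`; `KNCells2ChainBandRO`): the band's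
# backward extent `ρ₀ = 3q + s₁ + 2R'` is an ALONG-axis quantity (room `ρ₀ ≤ 5 r∥`), its `ρ` is TRANSVERSE only (room `ρ ≤ 2 r⊥`) — no axis-ratio
# condition.  Same API as `KNCells2ChainCorridorS` with `R` in the names; the plain variant stays (valid, coupled).

builds on p205010 (kernel theorem, internal audit signed; external expert review pending) — nothing in this file uses p205010.
Lane `prim-bschramm`, seat `prim-bschramm-p5` (gen 6; (C) column of the D″ order of battle), helper file (`--supports stmt-CriticalPhenomena-4575 --as helper`).
* §1 `Corr.CorrROK`, `Corr.loc₁₂R/join₂R`, **`Corr.scheduleR (h : CorrROK …) a hσ c`**, `scheduleR_params/_prism/_core_zero/_core_last/_step₁/_step₂/_step₃`;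
* §2 rooms over `PCells2`: **`scheduleR_core_zero_eq_M`**, **`scheduleR_prism_subset`** (`hρ₀ : 3q + s₁ + 2R' ≤ 5 r∥` along, `hρ₂ : ρ ≤ 2 r⊥` across),
  `scheduleR_region_subset`, **`scheduleR_core_last_subset`**.
[cite: KozmaNitzan2024, §4 Lemma 11 (pp. 22–23), Lemma 12 (pp. 23–25), p. 26 (M_v, H_{v,x}), p. 31]
-/

noncomputable section

namespace Summit.CriticalPhenomena.PercolationContinuityZ3.Theorems

namespace Transplant

namespace ChainPlanar

namespace Corr

open Literature.Probability.Percolation Literature.Probability.LatticeModels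
open Literature.Probability.Percolation.KozmaNitzan
open Literature.Probability.Percolation.KozmaNitzan.Cells (oth oth_ne eq_oth_of_ne oth_oth sgOf sgOf_sign)

/-! ## §1 The corridor schedule with the rooted band -/

/-- **The parameter hypotheses of the corridor schedule, rooted-band variant**: as `CorrOK` with phase 3 admissible by `Band.BandOKR` (no
coupling between the band's backward extent and its transverse width). [cite: KozmaNitzan2024, §4 Lemma 12 (pp. 23–25)] -/
structure CorrROK (L₁₀ W₁₀ L₂₀ W₂₀ q q' s₁ ρ : ℤ) (R' ℓ₀₁ ℓ₁₁ WM₁ N₁ ℓ₀₂ ℓ₁₂ WM₂ N₂ ℓ₀₃ N₃ WM₃ ℓ₁₃ : ℕ) (Wb₁ Wb₂ Wb₃ : ℕ → ℕ) : Prop where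
  /-- phase 1 is a localisation schedule -/
  loc₁ : Loc.LocOK L₁₀ W₁₀ R' ℓ₀₁ ℓ₁₁ WM₁ Wb₁
  /-- phase 2 is a localisation schedule -/
  loc₂ : Loc.LocOK L₂₀ W₂₀ R' ℓ₀₂ ℓ₁₂ WM₂ Wb₂
  /-- phase 3 is a rooted band run -/
  band : Band.BandOKR q q' s₁ ρ R' ℓ₀₃ N₃ WM₃ Wb₃
  /-- the band's extents are certified up to `ℓ₁₃` -/
  hℓ₁₃ : 2 * q + s₁ + R' ≤ (ℓ₁₃ : ℤ)
  /-- join 1: the along-width of phase 2 starts at the transverse width phase 1 ends with -/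
  hL₂ : L₂₀ = Loc.W W₁₀ R' WM₁ (N₁ + 1)
  /-- join 1: the transverse width of phase 2 starts at the along-width phase 1 ends with -/
  hW₂ : W₂₀ = Loc.L L₁₀ R' ℓ₀₁ ℓ₁₁ (N₁ + 1)
  /-- join 2: the band's start half-length is the along-width phase 2 ends with -/
  hq : q = Loc.L L₂₀ R' ℓ₀₂ ℓ₁₂ (N₂ + 1)
  /-- join 2: the band's start half-width is the transverse width phase 2 ends with -/
  hq' : q' = Loc.W W₂₀ R' WM₂ (N₂ + 1)

variable {L₁₀ W₁₀ L₂₀ W₂₀ q q' s₁ ρ : ℤ} {R' ℓ₀₁ ℓ₁₁ WM₁ N₁ ℓ₀₂ ℓ₁₂ WM₂ N₂ ℓ₀₃ N₃ WM₃ ℓ₁₃ : ℕ} {Wb₁ Wb₂ Wb₃ : ℕ → ℕ}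
  (h : CorrROK L₁₀ W₁₀ L₂₀ W₂₀ q q' s₁ ρ R' ℓ₀₁ ℓ₁₁ WM₁ N₁ ℓ₀₂ ℓ₁₂ WM₂ N₂ ℓ₀₃ N₃ WM₃ ℓ₁₃ Wb₁ Wb₂ Wb₃)
  (a : Fin 2) {σ : ℤ} (hσ : σ = 1 ∨ σ = -1) (c : Site 2)

/-- The first two phases appended (rooted variant; the join — first core of phase 2 = last core of phase 1 — is `Corr.join₁`'s computation,
inlined). [folklore] -/
def loc₁₂R : Schedule :=
  (Loc.schedule h.loc₁ (oth a) c N₁).append (Loc.schedule h.loc₂ a c N₂) rfl (by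
    rw [Loc.schedule_core, Loc.schedule_core, (Loc.schedule_params h.loc₁ (oth a) c N₁).1, Loc.core, Loc.core, Loc.L_zero, Loc.W_zero, h.hL₂,
      h.hW₂, sBox_symm_swap])

/-- **Join 2** (rooted variant): the first core of the rooted band run is the last core of phase 2. [folklore] -/
theorem join₂R : (Band.scheduleRO hσ c a h.band h.hℓ₁₃).core 0 = (loc₁₂R h a c).core ((loc₁₂R h a c).N + 1) := by
  rw [loc₁₂R, Schedule.append_core_last, Band.scheduleRO_core_zero hσ c a h.band h.hℓ₁₃, Loc.schedule_core,
    (Loc.schedule_params h.loc₂ a c N₂).1, Loc.core, ← h.hq, ← h.hq', sBox_symm_sign hσ]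

/-- **THE CORRIDOR SCHEDULE, ROOTED-BAND VARIANT**: localise across, localise along, rooted band run along `a` with sign `σ`, about `c`.
[cite: KozmaNitzan2024, §4 Lemma 12 (pp. 23–25)] -/
def scheduleR : Schedule := (loc₁₂R h a c).append (Band.scheduleRO hσ c a h.band h.hℓ₁₃) rfl (join₂R h a hσ c)

/-- The parameters of the rooted corridor schedule. [folklore] -/
theorem scheduleR_params : (scheduleR h a hσ c).N = N₁ + 1 + N₂ + 1 + N₃ ∧ (scheduleR h a hσ c).R' = R' ∧
    (scheduleR h a hσ c).ℓ₀ = min (min ℓ₀₁ ℓ₀₂) ℓ₀₃ ∧ (scheduleR h a hσ c).ℓ₁ = max (max ℓ₁₁ ℓ₁₂) ℓ₁₃ :=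
  ⟨rfl, rfl, rfl, rfl⟩

/-- **The prism of the rooted corridor schedule**: the two localisation regions and the rooted band prism (backward `ρ₀`, transverse `ρ`). [folklore] -/
theorem scheduleR_prism : (scheduleR h a hσ c).prism =
    (Loc.region L₁₀ W₁₀ R' ℓ₀₁ ℓ₁₁ WM₁ (oth a) c (N₁ + 1) ∪ Loc.region L₂₀ W₂₀ R' ℓ₀₂ ℓ₁₂ WM₂ a c (N₂ + 1)) ∪
      sBox a σ c (-(Adv.ρ₀ q s₁ R')) (q + ((N₃ : ℤ) + 1) * s₁) ρ := rfl

/-- The first core of the rooted corridor schedule is the start box. [folklore] -/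
theorem scheduleR_core_zero : (scheduleR h a hσ c).core 0 = sBox (oth a) 1 c (-L₁₀) L₁₀ W₁₀ := by
  rw [scheduleR, Schedule.append_core_zero, loc₁₂R, Schedule.append_core_zero, Loc.schedule_core_zero]

/-- The last core of the rooted corridor schedule is the far line core of the band. [folklore] -/
theorem scheduleR_core_last : (scheduleR h a hσ c).core ((scheduleR h a hσ c).N + 1) =
    sBox a σ c (q + ((N₃ : ℤ) + 1) * s₁) (q + ((N₃ : ℤ) + 1) * s₁) (Band.w₁ q' R' WM₃ + (N₃ : ℤ) * R') := by
  rw [scheduleR, Schedule.append_core_last, (Band.scheduleRO_params hσ c a h.band h.hℓ₁₃).1, Band.scheduleRO_core_last hσ c a h.band h.hℓ₁₃]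

/-- Phase 1 steps of the rooted corridor schedule (`k ≤ N₁`). [folklore] -/
theorem scheduleR_step₁ {k : ℕ} (hk : k ≤ N₁) : (scheduleR h a hσ c).ax k = oth a ∧ (scheduleR h a hσ c).Wb k = Wb₁ ∧
    (scheduleR h a hσ c).region k = Loc.region L₁₀ W₁₀ R' ℓ₀₁ ℓ₁₁ WM₁ (oth a) c (N₁ + 1) ∧
    (scheduleR h a hσ c).core k = Loc.core L₁₀ W₁₀ R' ℓ₀₁ ℓ₁₁ WM₁ (oth a) c k := by
  have hk' : k ≤ (loc₁₂R h a c).N := by show k ≤ N₁ + 1 + N₂; omega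
  refine ⟨?_, ?_, ?_, ?_⟩
  · rw [scheduleR, Schedule.append_ax_left _ _ _ _ hk', loc₁₂R, Schedule.append_ax_left _ _ _ _ hk, Loc.schedule_ax]
  · rw [scheduleR, Schedule.append_Wb_left _ _ _ _ hk', loc₁₂R, Schedule.append_Wb_left _ _ _ _ hk, Loc.schedule_Wb]
  · rw [scheduleR, Schedule.append_region_left _ _ _ _ hk', loc₁₂R, Schedule.append_region_left _ _ _ _ hk, Loc.schedule_region]
  · rw [scheduleR, Schedule.append_core_left _ _ _ _ hk', loc₁₂R, Schedule.append_core_left _ _ _ _ hk, Loc.schedule_core]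

/-- Phase 2 steps of the rooted corridor schedule (`N₁ + 1 + j`, `j ≤ N₂`). [folklore] -/
theorem scheduleR_step₂ {j : ℕ} (hj : j ≤ N₂) : (scheduleR h a hσ c).ax (N₁ + 1 + j) = a ∧ (scheduleR h a hσ c).Wb (N₁ + 1 + j) = Wb₂ ∧
    (scheduleR h a hσ c).region (N₁ + 1 + j) = Loc.region L₂₀ W₂₀ R' ℓ₀₂ ℓ₁₂ WM₂ a c (N₂ + 1) ∧
    (scheduleR h a hσ c).core (N₁ + 1 + j) = Loc.core L₂₀ W₂₀ R' ℓ₀₂ ℓ₁₂ WM₂ a c j := by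
  have hk' : N₁ + 1 + j ≤ (loc₁₂R h a c).N := by show N₁ + 1 + j ≤ N₁ + 1 + N₂; omega
  refine ⟨?_, ?_, ?_, ?_⟩
  · rw [scheduleR, Schedule.append_ax_left _ _ _ _ hk', loc₁₂R]
    exact (Schedule.append_ax_right _ _ _ _ j).trans (Loc.schedule_ax _ _ _ _ _)
  · rw [scheduleR, Schedule.append_Wb_left _ _ _ _ hk', loc₁₂R]
    exact (Schedule.append_Wb_right _ _ _ _ j).trans (Loc.schedule_Wb _ _ _ _ _)
  · rw [scheduleR, Schedule.append_region_left _ _ _ _ hk', loc₁₂R]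
    exact (Schedule.append_region_right _ _ _ _ j).trans (Loc.schedule_region _ _ _ _ _)
  · rw [scheduleR, Schedule.append_core_left _ _ _ _ hk', loc₁₂R]
    exact (Schedule.append_core_right _ _ _ _ j).trans (Loc.schedule_core _ _ _ _ _)

/-- Phase 3 steps of the rooted corridor schedule (`N₁ + 1 + N₂ + 1 + j`). [folklore] -/
theorem scheduleR_step₃ (j : ℕ) : (scheduleR h a hσ c).ax (N₁ + 1 + N₂ + 1 + j) = a ∧ (scheduleR h a hσ c).Wb (N₁ + 1 + N₂ + 1 + j) = Wb₃ ∧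
    (scheduleR h a hσ c).region (N₁ + 1 + N₂ + 1 + j) = Band.regionR q s₁ ρ R' a σ c j ∧
    (scheduleR h a hσ c).core (N₁ + 1 + N₂ + 1 + j) = Band.core q q' s₁ R' WM₃ a σ c j := by
  refine ⟨?_, ?_, ?_, ?_⟩
  · rw [scheduleR]
    exact (Schedule.append_ax_right _ _ _ _ j).trans (Band.scheduleRO_ax _ _ _ _ _ _)
  · rw [scheduleR]
    exact (Schedule.append_Wb_right _ _ _ _ j).trans (Band.scheduleRO_Wb _ _ _ _ _ _)
  · rw [scheduleR]
    exact (Schedule.append_region_right _ _ _ _ j).trans (congrFun (Band.scheduleRO_region hσ c a h.band h.hℓ₁₃) j)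
  · rw [scheduleR]
    exact (Schedule.append_core_right _ _ _ _ j).trans (Band.scheduleRO_core _ _ _ _ _ _)

/-! ## §2 The two-unit rooms of the rooted corridor schedule -/

variable (P : PCells2) (x : Site 2) (du : MDir)

/-- **The rooted corridor schedule of the probe `(x, du)` starts at the arrival box** (`L₁₀ = 3 r⊥`, `W₁₀ = 3 r∥`). [folklore] -/
theorem scheduleR_core_zero_eq_M (hL : L₁₀ = 3 * (P.r (oth du.1) : ℤ)) (hW : W₁₀ = 3 * (P.r du.1 : ℤ)) :
    (scheduleR h du.1 (sgOf_sign du) (P.cen x)).core 0 = P.M x := by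
  rw [scheduleR_core_zero, hL, hW, P.M_eq_sBox_symm x (oth du.1), oth_oth]

/-- **The prism of the rooted corridor schedule lies in `Q_x ∪ H_{x,du}`**: localisation rooms as before, and for the band the ALONG room
`hρ₀ : 3q + s₁ + 2R' ≤ 5 r∥` (backward extent of region 0 inside the cube box) and the TRANSVERSE room `hρ₂ : ρ ≤ 2 r⊥` — no axis-ratio condition.
[cite: KozmaNitzan2024, §4 Lemma 12 (pp. 23–25), p. 26] -/
theorem scheduleR_prism_subset
    (h₁L : max L₁₀ (ℓ₀₁ : ℤ) + R' + ℓ₁₁ ≤ 5 * (P.r (oth du.1) : ℤ)) (h₁W : Loc.W W₁₀ R' WM₁ (N₁ + 1) + R' + WM₁ ≤ 5 * (P.r du.1 : ℤ))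
    (h₂L : max L₂₀ (ℓ₀₂ : ℤ) + R' + ℓ₁₂ ≤ 5 * (P.r du.1 : ℤ)) (h₂W : Loc.W W₂₀ R' WM₂ (N₂ + 1) + R' + WM₂ ≤ 5 * (P.r (oth du.1) : ℤ))
    (hρ₀ : 3 * q + s₁ + 2 * R' ≤ 5 * (P.r du.1 : ℤ)) (hρ₂ : ρ ≤ 2 * (P.r (oth du.1) : ℤ)) (hfar : q + ((N₃ : ℤ) + 1) * s₁ ≤ 22 * (P.r du.1 : ℤ)) :
    (scheduleR h du.1 (sgOf_sign du) (P.cen x)).prism ⊆ P.Q x ∪ P.Hfull x du := by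
  rw [scheduleR_prism]
  refine Finset.union_subset (Finset.union_subset ?_ ?_) ?_
  · refine subset_trans ?_ Finset.subset_union_left
    rw [Loc.region]
    refine P.sBox_symm_subset_Q x (oth du.1) h₁L ?_
    rw [oth_oth]; exact h₁W
  · refine subset_trans ?_ Finset.subset_union_left
    rw [Loc.region]
    exact P.sBox_symm_subset_Q x du.1 h₂L h₂W
  · exact P.sBox_subset_Q_union_Hfull x du (by rw [Adv.ρ₀]; linarith) hfar hρ₂

/-- Every region of the rooted corridor schedule lies in `Q_x ∪ H_{x,du}`. [folklore] -/
theorem scheduleR_region_subset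
    (h₁L : max L₁₀ (ℓ₀₁ : ℤ) + R' + ℓ₁₁ ≤ 5 * (P.r (oth du.1) : ℤ)) (h₁W : Loc.W W₁₀ R' WM₁ (N₁ + 1) + R' + WM₁ ≤ 5 * (P.r du.1 : ℤ))
    (h₂L : max L₂₀ (ℓ₀₂ : ℤ) + R' + ℓ₁₂ ≤ 5 * (P.r du.1 : ℤ)) (h₂W : Loc.W W₂₀ R' WM₂ (N₂ + 1) + R' + WM₂ ≤ 5 * (P.r (oth du.1) : ℤ))
    (hρ₀ : 3 * q + s₁ + 2 * R' ≤ 5 * (P.r du.1 : ℤ)) (hρ₂ : ρ ≤ 2 * (P.r (oth du.1) : ℤ)) (hfar : q + ((N₃ : ℤ) + 1) * s₁ ≤ 22 * (P.r du.1 : ℤ))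
    {k : ℕ} (hk : k ≤ (scheduleR h du.1 (sgOf_sign du) (P.cen x)).N) :
    (scheduleR h du.1 (sgOf_sign du) (P.cen x)).region k ⊆ P.Q x ∪ P.Hfull x du :=
  ((scheduleR h du.1 (sgOf_sign du) (P.cen x)).sub_prism k hk).trans (scheduleR_prism_subset h P x du h₁L h₁W h₂L h₂W hρ₀ hρ₂ hfar)

/-- The last core of the rooted corridor schedule enters the arrival box of the next cell. [cite: KozmaNitzan2024, §4 Lemma 12 (pp. 23–25)] -/
theorem scheduleR_core_last_subset (h17 : 17 * (P.r du.1 : ℤ) ≤ q + ((N₃ : ℤ) + 1) * s₁) (h22 : q + ((N₃ : ℤ) + 1) * s₁ ≤ 22 * (P.r du.1 : ℤ))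
    (hw : Band.w₁ q' R' WM₃ + (N₃ : ℤ) * R' ≤ 2 * (P.r (oth du.1) : ℤ)) :
    (scheduleR h du.1 (sgOf_sign du) (P.cen x)).core ((scheduleR h du.1 (sgOf_sign du) (P.cen x)).N + 1) ⊆ P.M (x + stepVec du) ∩ P.Hfull x du := by
  rw [scheduleR_core_last]
  exact P.sBox_subset_M_add_inter_Hfull x du h17 h22 hw

end Corr

end ChainPlanar

end Transplant

end Summit.CriticalPhenomena.PercolationContinuityZ3.Theorems

end
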